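import Summits.Schanuel.Schanuel.Theorems.ZilberEacGraphLinearWitness
import Mathlib.Analysis.Calculus.ImplicitContDiff
import Mathlib.Analysis.Calculus.Deriv.Inv
import HarnessLib

/-!
# The equimodular class, XXIII: the ANALYTIC BRANCH at infinity of a fibre curve at a simple
# nonzero root of its top row

HONEST FRAMING.  Cell `pub-schanuel` (Zilber's Exponential-Algebraic Closedness, case ladder;
host summit Schanuel), seat 2, gen 24.  Let `Q = Σ_j q_j(s) t^j ∈ ℂ[s][t]` be a fibre polynomial
whose rows have degree `≤ N`, and let `T = Σ_j [s^N]q_j · X^j` be its TOP ROW.  If `θ ≠ 0` is a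
SIMPLE root of `T`, the implicit function theorem for the analytic equation
`Φ(u, y) = Σ_j (Σ_i q_{j,i} u^{N-i}) y^j = u^N Q(1/u, y) = 0` at `(0, θ)` (`Φ(0, ·) = T`,
`∂_y Φ(0, θ) = T'(θ) ≠ 0`; Mathlib's `ContDiffAt.implicitFunction` with `n = ω`) produces
**`exists_fibreBranch`**: a function `ψ` analytic near `0` with `ψ(0) = θ` such that for all small
`u ≠ 0` the value `ψ(u)` is THE root of `Q(1/u, ·)` near `θ` (existence and uniqueness), `ψ` is
zero-free with `ψ/θ` near `1`, `|ψ'(u) u²/ψ(u)| < 1` (the logarithmic derivative of the branch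
`ρ(z) = ψ(1/z)` is small), and `(Σ_j j q_j(1/u) ψ(u)^j) ≠ 0` (the root stays simple).  Along the
exponential points of `{x₁ = p(x₀), Q(x₀, y₀) = 0}` near the labels `log θ + 2πik` one has
`e^{x₀} = ψ(1/x₀)` EXACTLY (file XXIV), which feeds the polar correction of gen 23 with the analytic
datum `r̃ = ψ/θ` (file XXV).  [folklore: implicit function theorem]; nothing here is specific to
Schanuel's conjecture (neither used nor implied); Mantova–Masser's question and EC(3,2) stay OPEN.
-/

noncomputable section

open Filter Topology Polynomial Metric
open scoped ContDiff

set_option linter.dupNamespace false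

namespace Summit.Schanuel.Schanuel.Theorems

/-! ## Part A. The reversed fibre polynomial `Φ(u, y) = u^N Q(1/u, y)` -/

/-- `Φ(u, y) = u^N Q(1/u, y)` for `u ≠ 0` (rows of degree `≤ N`). [folklore] -/
theorem revPP_eq (Q : ℂ[X][X]) {N : ℕ} (hN : ∀ j, (Q.coeff j).natDegree ≤ N) {u : ℂ} (hu : u ≠ 0)
    (y : ℂ) :
    (∑ j ∈ Finset.range (Q.natDegree + 1),
        (∑ i ∈ Finset.range (N + 1), (Q.coeff j).coeff i * u ^ (N - i)) * y ^ j) =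
      u ^ N * (Q.map (Polynomial.evalRingHom u⁻¹)).eval y := by
  rw [evalPP_eq_sum Q u⁻¹ y (Nat.lt_succ_self _), Finset.mul_sum]
  refine Finset.sum_congr rfl fun j _ => ?_
  rw [← pow_mul_eval_inv_eq_sum (Q.coeff j) (hN j) hu]
  ring

/-- The top row has `t`-degree at most that of `Q`. [folklore] -/
theorem natDegree_topRow_le (Q : ℂ[X][X]) (N : ℕ) (T : ℂ[X])
    (hT : ∀ j, T.coeff j = (Q.coeff j).coeff N) : T.natDegree ≤ Q.natDegree := by
  rw [Polynomial.natDegree_le_iff_coeff_eq_zero]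
  intro j hj
  rw [hT, Polynomial.coeff_eq_zero_of_natDegree_lt (p := Q) hj, Polynomial.coeff_zero]

/-- `Φ(0, y) = T(y)`. [folklore] -/
theorem revPP_zero (Q : ℂ[X][X]) (N : ℕ) (T : ℂ[X]) (hT : ∀ j, T.coeff j = (Q.coeff j).coeff N)
    (y : ℂ) :
    (∑ j ∈ Finset.range (Q.natDegree + 1),
        (∑ i ∈ Finset.range (N + 1), (Q.coeff j).coeff i * (0 : ℂ) ^ (N - i)) * y ^ j) = T.eval y := by
  rw [Polynomial.eval_eq_sum_range' (Nat.lt_succ_of_le (natDegree_topRow_le Q N T hT))]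
  refine Finset.sum_congr rfl fun j _ => ?_
  rw [revSum_zero, hT]

/-- The weighted polynomial `Σ j q_j t^j` has rows of degree `≤ N` too. [folklore] -/
theorem natDegree_coeff_weightDeg_le (Q : ℂ[X][X]) {N : ℕ} (hN : ∀ j, (Q.coeff j).natDegree ≤ N)
    (j : ℕ) : ((weightDeg Q).coeff j).natDegree ≤ N := by
  rw [coeff_weightDeg]
  split_ifs
  · exact (Polynomial.natDegree_mul_le).trans (by
      rw [← Polynomial.C_eq_natCast, Polynomial.natDegree_C, zero_add]; exact hN j)
  · simp

/-- `u^N · (Σ j q_j(1/u) y^j) = Σ_j j (Σ_i q_{j,i} u^{N-i}) y^j` for `u ≠ 0`. [folklore] -/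
theorem revW_eq (Q : ℂ[X][X]) {N : ℕ} (hN : ∀ j, (Q.coeff j).natDegree ≤ N) {u : ℂ} (hu : u ≠ 0)
    (y : ℂ) :
    (∑ j ∈ Finset.range (Q.natDegree + 1),
        (j : ℂ) * (∑ i ∈ Finset.range (N + 1), (Q.coeff j).coeff i * u ^ (N - i)) * y ^ j) =
      u ^ N * ((weightDeg Q).map (Polynomial.evalRingHom u⁻¹)).eval y := by
  rw [eval_weightDeg, Finset.mul_sum]
  refine Finset.sum_congr rfl fun j _ => ?_
  rw [← pow_mul_eval_inv_eq_sum (Q.coeff j) (hN j) hu]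
  ring

/-- `Σ_j j (Σ_i q_{j,i} 0^{N-i}) y^j = y T'(y)`. [folklore] -/
theorem revW_zero (Q : ℂ[X][X]) (N : ℕ) (T : ℂ[X]) (hT : ∀ j, T.coeff j = (Q.coeff j).coeff N)
    (y : ℂ) :
    (∑ j ∈ Finset.range (Q.natDegree + 1),
        (j : ℂ) * (∑ i ∈ Finset.range (N + 1), (Q.coeff j).coeff i * (0 : ℂ) ^ (N - i)) * y ^ j) =
      y * (derivative T).eval y := by
  have hderiv : (derivative T).natDegree < Q.natDegree + 1 :=
    Nat.lt_succ_of_le ((Polynomial.natDegree_derivative_le T).trans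
      ((Nat.sub_le _ _).trans (natDegree_topRow_le Q N T hT)))
  have hTc : ∀ j, Q.natDegree < j → T.coeff j = 0 := fun j hj => by
    rw [hT, Polynomial.coeff_eq_zero_of_natDegree_lt (p := Q) hj, Polynomial.coeff_zero]
  calc (∑ j ∈ Finset.range (Q.natDegree + 1),
        (j : ℂ) * (∑ i ∈ Finset.range (N + 1), (Q.coeff j).coeff i * (0 : ℂ) ^ (N - i)) * y ^ j)
      = ∑ j ∈ Finset.range (Q.natDegree + 1), (j : ℂ) * T.coeff j * y ^ j := by
        refine Finset.sum_congr rfl fun j _ => ?_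
        rw [revSum_zero, hT]
    _ = ∑ j ∈ Finset.range Q.natDegree, ((j + 1 : ℕ) : ℂ) * T.coeff (j + 1) * y ^ (j + 1) := by
        rw [Finset.sum_range_succ']
        simp
    _ = ∑ j ∈ Finset.range (Q.natDegree + 1), ((j + 1 : ℕ) : ℂ) * T.coeff (j + 1) * y ^ (j + 1) := by
        rw [Finset.sum_range_succ, hTc _ (Nat.lt_succ_self _)]
        simp
    _ = y * (derivative T).eval y := by
        rw [Polynomial.eval_eq_sum_range' hderiv, Finset.mul_sum]
        refine Finset.sum_congr rfl fun j _ => ?_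
        rw [Polynomial.coeff_derivative]
        push_cast
        ring

/-! ## Part B. The analytic branch at infinity -/

/-- **The analytic branch of a fibre curve at a simple nonzero root of its top row.**  See the
module docstring. [folklore: implicit function theorem for analytic equations] (new in this form) -/
theorem exists_fibreBranch (Q : ℂ[X][X]) (N : ℕ) (hN : ∀ j, (Q.coeff j).natDegree ≤ N)
    (T : ℂ[X]) (hT : ∀ j, T.coeff j = (Q.coeff j).coeff N) {θ : ℂ} (hθ0 : θ ≠ 0)
    (hTθ : T.IsRoot θ) (hT'θ : (derivative T).eval θ ≠ 0) :
    ∃ (ψ : ℂ → ℂ) (δ : ℝ), 0 < δ ∧ ψ 0 = θ ∧ AnalyticAt ℂ ψ 0 ∧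
      (∀ u : ℂ, ‖u‖ < δ → AnalyticAt ℂ ψ u ∧ ψ u ≠ 0 ∧ ‖ψ u / θ - 1‖ < 1 / 2 ∧
        ‖deriv ψ u * u ^ 2 / ψ u‖ < 1 ∧
        (u ≠ 0 → ((weightDeg Q).map (Polynomial.evalRingHom u⁻¹)).eval (ψ u) ≠ 0)) ∧
      (∀ u : ℂ, ‖u‖ < δ → u ≠ 0 → (Q.map (Polynomial.evalRingHom u⁻¹)).eval (ψ u) = 0) ∧
      (∀ u y : ℂ, ‖u‖ < δ → ‖y - θ‖ < δ → u ≠ 0 →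
        (Q.map (Polynomial.evalRingHom u⁻¹)).eval y = 0 → y = ψ u) := by
  classical
  -- the reversed polynomial as a function on `ℂ × ℂ`
  set Φ : ℂ × ℂ → ℂ := fun v => ∑ j ∈ Finset.range (Q.natDegree + 1),
      (∑ i ∈ Finset.range (N + 1), (Q.coeff j).coeff i * v.1 ^ (N - i)) * v.2 ^ j with hΦ
  have hΦcd : ContDiff ℂ ω Φ := by
    simp only [hΦ]
    refine ContDiff.sum fun j _ => ContDiff.mul (ContDiff.sum fun i _ => ?_) (contDiff_snd.pow _)
    exact contDiff_const.mul (contDiff_fst.pow _)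
  have hΦeq : ∀ u : ℂ, u ≠ 0 → ∀ y, Φ (u, y) = u ^ N * (Q.map (Polynomial.evalRingHom u⁻¹)).eval y :=
    fun u hu y => revPP_eq Q hN hu y
  have hΦ0 : ∀ y, Φ (0, y) = T.eval y := fun y => revPP_zero Q N T hT y
  have hΦθ : Φ (0, θ) = 0 := by rw [hΦ0]; exact hTθ
  -- the partial derivative in `y` at `(0, θ)` is multiplication by `T'(θ) ≠ 0`
  have hΦat : ContDiffAt ℂ ω Φ ((0 : ℂ), θ) := hΦcd.contDiffAt
  have hcomp : HasFDerivAt (fun y : ℂ => Φ ((0 : ℂ), y))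
      ((fderiv ℂ Φ ((0 : ℂ), θ)).comp (ContinuousLinearMap.inr ℂ ℂ ℂ)) θ :=
    (hΦat.differentiableAt (by simp)).hasFDerivAt.comp θ (hasFDerivAt_prodMk_right (0 : ℂ) θ)
  have hTd : HasFDerivAt (fun y : ℂ => Φ ((0 : ℂ), y))
      (ContinuousLinearMap.smulRight (1 : ℂ →L[ℂ] ℂ) ((derivative T).eval θ)) θ := by
    have e : (fun y : ℂ => Φ ((0 : ℂ), y)) = fun y => T.eval y := funext hΦ0
    rw [e]
    exact (Polynomial.hasDerivAt T θ).hasFDerivAt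
  have hD2 : (fderiv ℂ Φ ((0 : ℂ), θ)).comp (ContinuousLinearMap.inr ℂ ℂ ℂ) =
      ContinuousLinearMap.smulRight (1 : ℂ →L[ℂ] ℂ) ((derivative T).eval θ) := hcomp.unique hTd
  have hinv : ((fderiv ℂ Φ ((0 : ℂ), θ)).comp (ContinuousLinearMap.inr ℂ ℂ ℂ)).IsInvertible := by
    rw [hD2]
    refine ⟨ContinuousLinearEquiv.unitsEquivAut ℂ (Units.mk0 _ hT'θ), ?_⟩
    ext
    simp [ContinuousLinearEquiv.unitsEquivAut_apply]
  -- the implicit function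
  have hω : (ω : ℕ∞ω) ≠ 0 := by simp
  set ψ : ℂ → ℂ := hΦat.implicitFunction hω hinv with hψ
  have hψ0 : ψ 0 = θ := hΦat.implicitFunction_apply_self hω hinv
  have hψan : AnalyticAt ℂ ψ 0 := (hΦat.contDiffAt_implicitFunction hω hinv).analyticAt
  have hψeq : ∀ᶠ u in 𝓝 (0 : ℂ), Φ (u, ψ u) = 0 := by
    have h := hΦat.eventually_apply_implicitFunction hω hinv
    rw [hΦθ] at h
    exact h
  have hψuniq : ∀ᶠ v in 𝓝 ((0 : ℂ), θ), Φ v = 0 → ψ v.1 = v.2 := by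
    have h := hΦat.eventually_apply_eq_iff_implicitFunction hω hinv
    rw [hΦθ] at h
    filter_upwards [h] with v hv using hv.1
  -- smallness conditions near `u = 0`
  have hψan' : ∀ᶠ u in 𝓝 (0 : ℂ), AnalyticAt ℂ ψ u := hψan.eventually_analyticAt
  have hψcont : ContinuousAt ψ 0 := hψan.continuousAt
  have hψne : ∀ᶠ u in 𝓝 (0 : ℂ), ‖ψ u / θ - 1‖ < 1 / 2 := by
    have hc : ContinuousAt (fun u => ψ u / θ - 1) 0 := (hψcont.div_const θ).sub continuousAt_const
    have := hc.eventually (Metric.ball_mem_nhds ((fun u => ψ u / θ - 1) 0) (by norm_num : (0:ℝ) < 1/2))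
    filter_upwards [this] with u hu
    have hu' : dist (ψ u / θ - 1) (ψ 0 / θ - 1) < 1 / 2 := hu
    rwa [hψ0, div_self hθ0, sub_self, dist_zero_right] at hu'
  have hψld : ∀ᶠ u in 𝓝 (0 : ℂ), ‖deriv ψ u * u ^ 2 / ψ u‖ < 1 := by
    have hdc : ContinuousAt (deriv ψ) 0 := hψan.deriv.continuousAt
    have hc : ContinuousAt (fun u : ℂ => deriv ψ u * u ^ 2 / ψ u) 0 :=
      (hdc.mul (continuousAt_id.pow 2)).div hψcont (by rw [hψ0]; exact hθ0)
    have := hc.eventually (Metric.ball_mem_nhds ((fun u : ℂ => deriv ψ u * u ^ 2 / ψ u) 0) one_pos)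
    filter_upwards [this] with u hu
    have hu' : dist (deriv ψ u * u ^ 2 / ψ u) (deriv ψ 0 * (0 : ℂ) ^ 2 / ψ 0) < 1 := hu
    rwa [zero_pow two_ne_zero, mul_zero, zero_div, dist_zero_right] at hu'
  have hψW : ∀ᶠ u in 𝓝 (0 : ℂ), (∑ j ∈ Finset.range (Q.natDegree + 1),
      (j : ℂ) * (∑ i ∈ Finset.range (N + 1), (Q.coeff j).coeff i * u ^ (N - i)) * ψ u ^ j) ≠ 0 := by
    have hc : ContinuousAt (fun u : ℂ => ∑ j ∈ Finset.range (Q.natDegree + 1),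
        (j : ℂ) * (∑ i ∈ Finset.range (N + 1), (Q.coeff j).coeff i * u ^ (N - i)) * ψ u ^ j) 0 := by
      refine tendsto_finsetSum _ fun j _ => ?_
      refine ((continuousAt_const.mul ?_).mul (hψcont.pow j))
      exact tendsto_finsetSum _ fun i _ => continuousAt_const.mul (continuousAt_id.pow _)
    refine hc.eventually_ne ?_
    rw [revW_zero Q N T hT, hψ0]
    exact mul_ne_zero hθ0 hT'θ
  -- collect everything in a ball
  obtain ⟨δ₁, hδ₁, h₁⟩ := Metric.eventually_nhds_iff_ball.1
    (hψeq.and (hψan'.and (hψne.and (hψld.and hψW))))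
  obtain ⟨δ₂, hδ₂, h₂⟩ := Metric.eventually_nhds_iff_ball.1 hψuniq
  set δ : ℝ := min δ₁ (δ₂ / 2) with hδ
  have hδpos : 0 < δ := by positivity
  have hball : ∀ u : ℂ, ‖u‖ < δ → u ∈ Metric.ball (0 : ℂ) δ₁ := fun u hu => by
    rw [Metric.mem_ball, dist_zero_right]; exact hu.trans_le (min_le_left _ _)
  refine ⟨ψ, δ, hδpos, hψ0, hψan, fun u hu => ?_, fun u hu hu0 => ?_, fun u y hu hy hu0 hQy => ?_⟩
  · obtain ⟨-, han, hne, hld, hW⟩ := h₁ u (hball u hu)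
    have hψu0 : ψ u ≠ 0 := by
      intro h
      rw [h, zero_div, zero_sub, norm_neg, norm_one] at hne
      norm_num at hne
    refine ⟨han, hψu0, hne, hld, fun hu0 hW0 => hW ?_⟩
    rw [revW_eq Q hN hu0, hW0, mul_zero]
  · obtain ⟨heq, -⟩ := h₁ u (hball u hu)
    rw [hΦeq u hu0] at heq
    exact (mul_eq_zero.1 heq).resolve_left (pow_ne_zero _ hu0)
  · have hv : ((u, y) : ℂ × ℂ) ∈ Metric.ball ((0 : ℂ), θ) δ₂ := by
      rw [Metric.mem_ball, Prod.dist_eq, max_lt_iff]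
      constructor
      · rw [dist_zero_right]
        exact hu.trans_le ((min_le_right _ _).trans (by linarith))
      · rw [dist_eq_norm]
        exact hy.trans_le ((min_le_right _ _).trans (by linarith))
    have h := h₂ (u, y) hv
    rw [hΦeq u hu0, hQy, mul_zero] at h
    exact (h rfl).symm

end Summit.Schanuel.Schanuel.Theorems
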